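import Literature.NumberTheory.Rogawski1990.CartanInvariant
import Literature.NumberTheory.Rogawski1990.AdelicStableClassSupportFiniteH
import Literature.NumberTheory.Rogawski1990.AdelicStableClassSupportFinite
import Literature.NumberTheory.GaloisRepresentations.HasseNormEtaleInvolutionMatrix
import Literature.LinearAlgebra.Matrix.NonderogatoryCommutantBaseChange
import Literature.LinearAlgebra.Matrix.CentraliserOfSeparableCharpoly
import HarnessLib

/-!
# Rational classes in a regular stable class inject into adelic classes: `k(γ₀) = |ker(𝔇(γ₀∕F) → 𝔇(γ₀∕𝐀))| = 1` for the unitary groups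
# `U(H)(L⁺)` (Rogawski 1990, §5.4 p. 72; Kottwitz 1986, §9) — assembly over the Cartan criterion and the Hasse norm theorem

Topic `NumberTheory/Rogawski1990`; namespace `Literature.NumberTheory.Rogawski1990`.  THEOREMS ONLY (no def, no named fact, no instance, no `sorry`).
Cell hodgecm-mathlib, floor-0 T1 line `F0_T1InnerFormTraceIdentity`, G6 «Hasse for the U(3) tori», row F3′ (GO #96∕#97): the step S4(b) of the
O11-0 census «the map `c ↦ [toAdelic (out c)]` is INJECTIVE on the rational classes inside a regular stable class».

STATEMENT. `L` a CM field, `H ∈ M_N(L)` (any `N`), `γ, γ′ ∈ U(H)(L⁺) = (UnitaryGroup.cmDatum L N H).Rational` with `γ` REGULAR (separable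
characteristic polynomial): if `γ ⊗ 1` and `γ′ ⊗ 1` are conjugate in `U(H)(𝔸) = (cmDatum L N H).Adelic`, then `γ` and `γ′` are conjugate in `U(H)(L⁺)`.
ROAD: (a) adelic conjugacy ⇒ equal characteristic polynomials ⇒ (regularity) `γ′ = g γ g⁻¹` in `GL_N(L)` (★ `isConj_of_charpoly_eq_of_separable`);
(b) ★ `CartanInvariant` at the ring `𝔸_L`: the transported form `H_g ⊗ 1` is `Z(γ ⊗ 1)`-congruent to `H ⊗ 1`; (c) the glue ★ `HasseNormEtaleInvolutionMatrix`
(A-p14: `Z_{M_N(𝔸_L)}(γ ⊗ 1) ≅ 𝔸_F ⊗_F L[γ]` + Hasse's norm theorem ★ `HasseNormEtaleInvolution` for the Cartan algebra) descends the congruence to `Z(γ)`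
over `L`; (d) ★ `CartanInvariant` at `R := L` backwards.

## References
* J. D. Rogawski, *Automorphic Representations of Unitary Groups in Three Variables*, Ann. of Math. Stud. 123 (1990), §3.1 p. 19, §5.4 p. 72. [Rogawski1990]
* R. Kottwitz, *Stable trace formula: elliptic singular terms*, Math. Ann. 275 (1986), §9. [Kottwitz1986]
-/

set_option autoImplicit false

noncomputable section

open NumberField IsDedekindDomain
open scoped MatrixGroups Matrix

namespace Literature.NumberTheory.Rogawski1990

open Literature.NumberTheory.Automorphic
open Literature.AlgebraicGeometry.ShimuraVarieties (unitaryGroup)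

variable {L : Type} [Field L] [NumberField L] [IsCMField L] {N : ℕ} {H : Matrix (Fin N) (Fin N) L}

/-- (a1) Conjugacy in `U(H)(𝔸)` gives conjugacy of the underlying invertible adelic matrices by a UNITARY adelic matrix. [cite: Rogawski1990, §5.4 p. 72] -/
theorem exists_unitary_conj_toAdelic_of_isConj {γ γ' : (UnitaryGroup.cmDatum L N H).Rational}
    (h : IsConj ((UnitaryGroup.cmDatum L N H).toAdelic γ) ((UnitaryGroup.cmDatum L N H).toAdelic γ')) :
    ∃ u ∈ adelicUnitaryGroup L H,
      u * (((UnitaryGroup.cmDatum L N H).toAdelic γ).val : GL (Fin N) (AdeleRing (𝓞 L) L)) * u⁻¹ =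
        (((UnitaryGroup.cmDatum L N H).toAdelic γ').val : GL (Fin N) (AdeleRing (𝓞 L) L)) := by
  obtain ⟨c, hc⟩ := isConj_iff.1 h
  refine ⟨c.val, c.2, ?_⟩
  exact congrArg Subtype.val hc

/-- (a2) Adelically conjugate rational elements have the same characteristic polynomial. [cite: Rogawski1990, §14.1 p. 232] -/
theorem charpoly_eq_of_isConj_toAdelic {γ γ' : (UnitaryGroup.cmDatum L N H).Rational}
    (h : IsConj ((UnitaryGroup.cmDatum L N H).toAdelic γ) ((UnitaryGroup.cmDatum L N H).toAdelic γ')) :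
    (((γ : unitaryGroup (cmConjRingHom L) H).val : GL (Fin N) L) : Matrix (Fin N) (Fin N) L).charpoly =
      (((γ' : unitaryGroup (cmConjRingHom L) H).val : GL (Fin N) L) : Matrix (Fin N) (Fin N) L).charpoly := by
  obtain ⟨u, -, hu⟩ := exists_unitary_conj_toAdelic_of_isConj h
  have hc : IsConj (((UnitaryGroup.cmDatum L N H).toAdelic γ).val : GL (Fin N) (AdeleRing (𝓞 L) L))
      (((UnitaryGroup.cmDatum L N H).toAdelic γ').val : GL (Fin N) (AdeleRing (𝓞 L) L)) := isConj_iff.2 ⟨u, hu⟩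
  have h1 := charpoly_eq_of_isConj_units hc
  rw [charpoly_toAdelic_eq_map, charpoly_toAdelic_eq_map] at h1
  exact Polynomial.map_injective _ (NumberField.AdeleRing.algebraMap_injective (𝓞 L) L) h1

/-- (a3) … hence, `γ` being REGULAR, they are stably conjugate (`GL_N(L)`-conjugate, ★ `isConj_of_charpoly_eq_of_separable`). [cite: Rogawski1990, §3.1 p. 19; §14.1 p. 232] -/
theorem isStablyConj_of_isConj_toAdelic {γ γ' : (UnitaryGroup.cmDatum L N H).Rational}
    (hreg : IsRegularElt ((γ : unitaryGroup (cmConjRingHom L) H).val : GL (Fin N) L))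
    (h : IsConj ((UnitaryGroup.cmDatum L N H).toAdelic γ) ((UnitaryGroup.cmDatum L N H).toAdelic γ')) :
    IsStablyConj (cmConjRingHom L) H γ γ' :=
  isConj_of_charpoly_eq_of_separable _ _ hreg (charpoly_eq_of_isConj_toAdelic h)

/-- (d) A `GL_N(L)`-conjugation realised by a unitary matrix is conjugacy in `U(H)(L⁺)`. [cite: Rogawski1990, §3.1 p. 19] -/
theorem isConj_of_exists_unitary_conj {γ γ' : (UnitaryGroup.cmDatum L N H).Rational}
    (h : ∃ u ∈ unitaryGroup (cmConjRingHom L) H,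
      u * ((γ : unitaryGroup (cmConjRingHom L) H).val : GL (Fin N) L) * u⁻¹ = (γ' : unitaryGroup (cmConjRingHom L) H).val) :
    IsConj γ γ' := by
  obtain ⟨u, hu, h⟩ := h
  exact isConj_iff.2 ⟨⟨u, hu⟩, Subtype.ext h⟩

/-- (b0) The adelic image of a rational element is its entrywise base change (definitional bridge). [folklore] -/
private theorem coe_toAdelic_eq_map (γ : (UnitaryGroup.cmDatum L N H).Rational) :
    (((UnitaryGroup.cmDatum L N H).toAdelic γ).val : GL (Fin N) (AdeleRing (𝓞 L) L)) =
      Matrix.GeneralLinearGroup.map (algebraMap L (AdeleRing (𝓞 L) L)) ((γ : unitaryGroup (cmConjRingHom L) H).val) := rfl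

/-- (b0') The adelic unitary group is the tree's `unitaryGroup` over `𝔸_L` for the involution `adeleConj L` and the form `H ⊗ 1` (definitional). [folklore] -/
private theorem adelicUnitaryGroup_eq : adelicUnitaryGroup L H = unitaryGroup (adeleConj L) (H.map (algebraMap L (AdeleRing (𝓞 L) L))) := rfl

/-- **(b) ADELIC CONJUGACY READ THROUGH THE CARTAN CRITERION AT `R := 𝔸_L`**: if `γ′ = g γ g⁻¹` in `GL_N(L)` and `γ ⊗ 1`, `γ′ ⊗ 1` are conjugate in
`U(H)(𝔸)`, then some `t ∈ GL_N(𝔸_L)` commuting with `γ ⊗ 1` satisfies `ᵗ(σ_𝔸 t) · (H_g ⊗ 1) · t = H ⊗ 1` (★ `exists_unitary_conj_iff_exists_commute_congr_eq`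
over the ring `𝔸_L` with the involution `adeleConj L`, ★ `twistGram_map`, ★ `adeleConj_algebraMap`). [cite: Rogawski1990, §3.1 p. 19; §5.4 p. 72] -/
theorem exists_commute_congr_twistGram_map_of_isConj_toAdelic {γ γ' : (UnitaryGroup.cmDatum L N H).Rational} {g : GL (Fin N) L}
    (hg : g * ((γ : unitaryGroup (cmConjRingHom L) H).val : GL (Fin N) L) * g⁻¹ = (γ' : unitaryGroup (cmConjRingHom L) H).val)
    (h : IsConj ((UnitaryGroup.cmDatum L N H).toAdelic γ) ((UnitaryGroup.cmDatum L N H).toAdelic γ')) :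
    ∃ t : GL (Fin N) (AdeleRing (𝓞 L) L),
      t * Matrix.GeneralLinearGroup.map (algebraMap L (AdeleRing (𝓞 L) L)) (γ : unitaryGroup (cmConjRingHom L) H).val =
          Matrix.GeneralLinearGroup.map (algebraMap L (AdeleRing (𝓞 L) L)) (γ : unitaryGroup (cmConjRingHom L) H).val * t ∧
        ((t : Matrix (Fin N) (Fin N) (AdeleRing (𝓞 L) L)).map (adeleConj L))ᵀ *
            (twistGram (cmConjRingHom L) H (g : Matrix (Fin N) (Fin N) L)).map (algebraMap L (AdeleRing (𝓞 L) L)) *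
            (t : Matrix (Fin N) (Fin N) (AdeleRing (𝓞 L) L)) =
          H.map (algebraMap L (AdeleRing (𝓞 L) L)) := by
  set ι := algebraMap L (AdeleRing (𝓞 L) L) with hι
  -- the adelic conjugation equation `g_𝔸 γ_𝔸 g_𝔸⁻¹ = γ′_𝔸`
  have hgA : Matrix.GeneralLinearGroup.map ι g * Matrix.GeneralLinearGroup.map ι (γ : unitaryGroup (cmConjRingHom L) H).val *
      (Matrix.GeneralLinearGroup.map ι g)⁻¹ = Matrix.GeneralLinearGroup.map ι (γ' : unitaryGroup (cmConjRingHom L) H).val := by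
    rw [← map_inv, ← map_mul, ← map_mul, hg]
  -- the unitary adelic conjugator
  obtain ⟨u, huc⟩ := isConj_iff.1 h
  have huc' : (u.val : GL (Fin N) (AdeleRing (𝓞 L) L)) * Matrix.GeneralLinearGroup.map ι (γ : unitaryGroup (cmConjRingHom L) H).val *
      (u.val)⁻¹ = Matrix.GeneralLinearGroup.map ι (γ' : unitaryGroup (cmConjRingHom L) H).val := congrArg Subtype.val huc
  -- R1 at `R := 𝔸_L`
  obtain ⟨t, ht, hHt⟩ := (exists_unitary_conj_iff_exists_commute_congr_eq (adeleConj L) (H.map ι) hgA).1 ⟨u.val, u.2, huc'⟩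
  refine ⟨t, ht, ?_⟩
  rw [twistGram_map (cmConjRingHom L) H (adeleConj L) ι (fun r => (adeleConj_algebraMap L r).symm)]
  exact hHt


/-- (e) The class-map form p08's `PreStabilisationCount(Self)` consumes: if adelic conjugacy of REGULAR rational elements implies rational
conjugacy, then `[δ] ↦ [δ ⊗ 1]` is injective on the rational classes inside the stable class of a regular `γ₀` (`k(γ₀) = 1`). [cite: Rogawski1990, §5.4 p. 72] -/
theorem injOn_conjClassesMap_toAdelic_of
    (hmain : ∀ γ γ' : (UnitaryGroup.cmDatum L N H).Rational,
      IsRegularElt ((γ : unitaryGroup (cmConjRingHom L) H).val : GL (Fin N) L) →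
      IsConj ((UnitaryGroup.cmDatum L N H).toAdelic γ) ((UnitaryGroup.cmDatum L N H).toAdelic γ') → IsConj γ γ')
    {γ₀ : (UnitaryGroup.cmDatum L N H).Rational} (hreg : IsRegularElt ((γ₀ : unitaryGroup (cmConjRingHom L) H).val : GL (Fin N) L)) :
    Set.InjOn (ConjClasses.map (UnitaryGroup.cmDatum L N H).toAdelic) (conjClassesIn (cmConjRingHom L) H γ₀) := by
  rintro c₁ hc₁ c₂ hc₂ h
  obtain ⟨δ₁, rfl⟩ := ConjClasses.mk_surjective c₁
  obtain ⟨δ₂, rfl⟩ := ConjClasses.mk_surjective c₂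
  have hδ₁ : IsRegularElt ((δ₁ : unitaryGroup (cmConjRingHom L) H).val : GL (Fin N) L) :=
    isRegularElt_of_isConj (mk_mem_conjClassesIn_iff.1 hc₁) hreg
  have h' : ConjClasses.mk ((UnitaryGroup.cmDatum L N H).toAdelic δ₁) = ConjClasses.mk ((UnitaryGroup.cmDatum L N H).toAdelic δ₂) := h
  exact ConjClasses.mk_eq_mk_iff_isConj.2 (hmain δ₁ δ₂ hδ₁ (ConjClasses.mk_eq_mk_iff_isConj.1 h'))

/-! ## The main theorem: `k(γ₀) = 1` -/

open Literature.LinearAlgebra.Matrix in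
/-- **RATIONAL CLASSES IN A REGULAR STABLE CLASS INJECT INTO ADELIC CLASSES** (`k(γ₀) = |ker(𝔇(γ₀∕F) → 𝔇(γ₀∕𝐀))| = 1`): for a CM field `L`,
a non-degenerate hermitian `H ∈ M_N(L)` (any `N`) and `γ, γ′ ∈ U(H)(L⁺)` with `γ` REGULAR semisimple, if `γ ⊗ 1` and `γ′ ⊗ 1` are conjugate in
`U(H)(𝔸_{L⁺})` then `γ` and `γ′` are conjugate in `U(H)(L⁺)`.  Assembly: (a) `γ′ = gγg⁻¹` in `GL_N(L)`; (b) ★ `CartanInvariant` over `𝔸_L`: `H_g ⊗ 1` is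
`Z(γ ⊗ 1)`-congruent to `H ⊗ 1`, i.e. with `x = H⁻¹H_g ∈ Z(γ)` and `c = t⁻¹`: `c · c⋆ = x ⊗ 1` (`Z(γ ⊗ 1)` commutative, ★ `NonderogatoryCommutantBaseChange`);
(c) ★ `exists_commute_mul_hermAdjoint_eq_of_adelic` (the Cartan algebra is étale with involution `⋆`; Hasse's norm theorem): `b · b⋆ = x` with
`b ∈ Z(γ)ˣ`; (d) `t′ = b⁻¹` gives `ᵗ(σ t′) H_g t′ = H`, ★ `CartanInvariant` over `L`. [cite: Rogawski1990, §5.4 p. 72] [cite: Kottwitz1986, §9] -/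
theorem UnitaryGroup.isConj_of_isConj_toAdelic (hH : (H.map (cmConjRingHom L))ᵀ = H) (hHdet : IsUnit H.det)
    {γ γ' : (UnitaryGroup.cmDatum L N H).Rational} (hreg : IsRegularElt ((γ : unitaryGroup (cmConjRingHom L) H).val : GL (Fin N) L))
    (h : IsConj ((UnitaryGroup.cmDatum L N H).toAdelic γ) ((UnitaryGroup.cmDatum L N H).toAdelic γ')) : IsConj γ γ' := by
  classical
  -- names
  set σr : L →+* L := cmConjRingHom L with hσr
  set ι : L →+* AdeleRing (𝓞 L) L := algebraMap L (AdeleRing (𝓞 L) L) with hι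
  set σA : AdeleRing (𝓞 L) L →+* AdeleRing (𝓞 L) L := adeleConj L with hσA
  have hσσ : ∀ r : L, σr (σr r) = r := fun r => IsCMField.complexConj_apply_apply L r
  have hισ : ∀ r : L, ι (σr r) = σA (ι r) := fun r => (adeleConj_algebraMap L r).symm
  set γM : Matrix (Fin N) (Fin N) L := (((γ : unitaryGroup (cmConjRingHom L) H).val : GL (Fin N) L) : Matrix (Fin N) (Fin N) L) with hγM
  have hγU : (γM.map σr)ᵀ * H * γM = H := (γ : unitaryGroup (cmConjRingHom L) H).2
  have hregM : γM.charpoly.Separable := hreg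
  -- (a) stable conjugacy
  obtain ⟨g, hg⟩ := isStablyConj_iff.1 (isStablyConj_of_isConj_toAdelic hreg h)
  -- (b) the adelic congruence
  obtain ⟨t, ht, hHt⟩ := exists_commute_congr_twistGram_map_of_isConj_toAdelic hg h
  -- the invariant `x = H⁻¹ H_g ∈ Z(γ)`
  set Hg : Matrix (Fin N) (Fin N) L := twistGram σr H (g : Matrix (Fin N) (Fin N) L) with hHg
  set x : Matrix (Fin N) (Fin N) L := H⁻¹ * Hg with hx
  have hxγ : Commute x γM := commute_inv_mul_twistGram σr H hHdet hg
  have hHgh : (Hg.map σr)ᵀ = Hg := conjTranspose_twistGram σr H hσσ hH _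
  have hHinvσ : ((H⁻¹).map σr)ᵀ = H⁻¹ := sigmaTranspose_nonsing_inv_of_hermitian σr hH hHdet
  have hxs : H⁻¹ * (x.map σr)ᵀ * H = x := by
    rw [hx, Matrix.map_mul, Matrix.transpose_mul, hHgh, hHinvσ]
    calc H⁻¹ * (Hg * H⁻¹) * H = H⁻¹ * Hg * (H⁻¹ * H) := by simp only [Matrix.mul_assoc]
      _ = H⁻¹ * Hg := by rw [Matrix.nonsing_inv_mul H hHdet, Matrix.mul_one]
  have hHgu : IsUnit Hg.det := by
    rw [hHg, twistGram_def, Matrix.det_mul, Matrix.det_mul, Matrix.det_transpose, ← RingHom.mapMatrix_apply, ← RingHom.map_det]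
    exact ((g.isUnit.map Matrix.detMonoidHom |>.map σr).mul hHdet).mul (g.isUnit.map Matrix.detMonoidHom)
  have hxu : IsUnit x.det := by
    rw [hx, Matrix.det_mul]
    exact (Matrix.isUnit_nonsing_inv_det H hHdet).mul hHgu
  -- adelic names
  set HA : Matrix (Fin N) (Fin N) (AdeleRing (𝓞 L) L) := H.map ι with hHA
  set γA : Matrix (Fin N) (Fin N) (AdeleRing (𝓞 L) L) := γM.map ι with hγA
  have hHAdet : IsUnit HA.det := by
    rw [hHA, ← RingHom.mapMatrix_apply, ← RingHom.map_det]; exact hHdet.map _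
  have hγAU : (γA.map σA)ᵀ * HA * γA = HA := by
    have hcomp : (σA : AdeleRing (𝓞 L) L → AdeleRing (𝓞 L) L) ∘ (ι : L → AdeleRing (𝓞 L) L) = (ι : L → AdeleRing (𝓞 L) L) ∘ (σr : L → L) :=
      funext fun r => (hισ r).symm
    have := congrArg (fun M : Matrix (Fin N) (Fin N) L => M.map ι) hγU
    simp only [Matrix.map_mul] at this
    rw [hγA, hHA, Matrix.map_map, hcomp, ← Matrix.map_map, ← Matrix.transpose_map]
    exact this
  have hHgA : Hg.map ι = twistGram σA HA ((g : Matrix (Fin N) (Fin N) L).map ι) := twistGram_map σr H σA ι hισ _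
  have hxA : x.map ι = HA⁻¹ * Hg.map ι := by
    rw [hx, Matrix.map_mul, hHA, map_nonsing_inv_of_isUnit ι hHdet]
  -- `c := t⁻¹` : `c ⋆c = x ⊗ 1` from `ᵗ(σ t) (H_g ⊗ 1) t = H ⊗ 1`
  set tM : Matrix (Fin N) (Fin N) (AdeleRing (𝓞 L) L) := (t : Matrix (Fin N) (Fin N) (AdeleRing (𝓞 L) L)) with htM
  set c : Matrix (Fin N) (Fin N) (AdeleRing (𝓞 L) L) := ((t⁻¹ : GL (Fin N) (AdeleRing (𝓞 L) L)) : Matrix (Fin N) (Fin N) (AdeleRing (𝓞 L) L))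
    with hc
  have htc : tM * c = 1 := by rw [htM, hc, ← Units.val_mul, mul_inv_cancel, Units.val_one]
  have hct : c * tM = 1 := by rw [htM, hc, ← Units.val_mul, inv_mul_cancel, Units.val_one]
  have hγA' : γA = ((Matrix.GeneralLinearGroup.map ι ((γ : unitaryGroup (cmConjRingHom L) H).val) : GL (Fin N) (AdeleRing (𝓞 L) L)) :
      Matrix (Fin N) (Fin N) (AdeleRing (𝓞 L) L)) := rfl
  have htγ : Commute tM γA := by
    have := congrArg (fun u : GL (Fin N) (AdeleRing (𝓞 L) L) => (u : Matrix (Fin N) (Fin N) (AdeleRing (𝓞 L) L))) ht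
    simp only [Units.val_mul] at this
    exact this
  have hcγ : Commute c γA := by
    -- `c γ = c γ (t c) = c (γ t) c … ` : from `t γ = γ t` and `c = t⁻¹`
    change c * γA = γA * c
    calc c * γA = c * γA * (tM * c) := by rw [htc, Matrix.mul_one]
      _ = c * (γA * tM) * c := by simp only [Matrix.mul_assoc]
      _ = c * (tM * γA) * c := by rw [htγ.eq]
      _ = (c * tM) * γA * c := by simp only [Matrix.mul_assoc]
      _ = γA * c := by rw [hct, Matrix.one_mul]
  -- `⋆t ⋆c = 1` and `x ⊗ 1 = ⋆c c`
  have hstar_tc : (HA⁻¹ * (tM.map σA)ᵀ * HA) * (HA⁻¹ * (c.map σA)ᵀ * HA) = 1 := by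
    rw [← hermAdjoint_mul σA hHAdet, hct, hermAdjoint_one σA hHAdet]
  have hxA' : x.map ι = (HA⁻¹ * (c.map σA)ᵀ * HA) * c := by
    -- `ᵗ(σt) Hg_A t = HA` ⇒ `HA⁻¹ ᵗ(σt) HA · x_A · t = 1` ⇒ `x_A = ⋆c · c`
    have h1 : (HA⁻¹ * (tM.map σA)ᵀ * HA) * (x.map ι) * tM = 1 := by
      rw [hxA]
      calc HA⁻¹ * (tM.map σA)ᵀ * HA * (HA⁻¹ * Hg.map ι) * tM = HA⁻¹ * (tM.map σA)ᵀ * (HA * HA⁻¹) * Hg.map ι * tM := by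
            simp only [Matrix.mul_assoc]
        _ = HA⁻¹ * ((tM.map σA)ᵀ * Hg.map ι * tM) := by rw [Matrix.mul_nonsing_inv HA hHAdet, Matrix.mul_one]; simp only [Matrix.mul_assoc]
        _ = 1 := by rw [hHt, Matrix.nonsing_inv_mul HA hHAdet]
    calc x.map ι = (HA⁻¹ * (c.map σA)ᵀ * HA) * ((HA⁻¹ * (tM.map σA)ᵀ * HA) * x.map ι * tM) * c := by
          calc x.map ι = ((HA⁻¹ * (tM.map σA)ᵀ * HA) * (HA⁻¹ * (c.map σA)ᵀ * HA)) * x.map ι * (tM * c) := by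
                rw [hstar_tc, htc, Matrix.one_mul, Matrix.mul_one]
            _ = _ := by
                -- reassociate using `⋆t ⋆c = ⋆c ⋆t`?  No: use `⋆c ⋆t = ⋆(t c) = 1` as well
                have h2 : (HA⁻¹ * (c.map σA)ᵀ * HA) * (HA⁻¹ * (tM.map σA)ᵀ * HA) = 1 := by
                  rw [← hermAdjoint_mul σA hHAdet, htc, hermAdjoint_one σA hHAdet]
                rw [hstar_tc, Matrix.one_mul]
                calc x.map ι * (tM * c) = 1 * x.map ι * (tM * c) := by rw [Matrix.one_mul]
                  _ = (HA⁻¹ * (c.map σA)ᵀ * HA) * (HA⁻¹ * (tM.map σA)ᵀ * HA) * x.map ι * (tM * c) := by rw [h2]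
                  _ = _ := by simp only [Matrix.mul_assoc]
      _ = (HA⁻¹ * (c.map σA)ᵀ * HA) * c := by rw [h1, Matrix.mul_one]
  have hcstarγ : Commute γA (HA⁻¹ * (c.map σA)ᵀ * HA) := commute_hermAdjoint_of_commute σA hHAdet hγAU hcγ.symm
  have hcc : c * (HA⁻¹ * (c.map σA)ᵀ * HA) = x.map ι := by
    rw [hxA']
    exact (commute_of_commute_map_of_charpoly_separable (R := AdeleRing (𝓞 L) L) γM hregM hcγ.symm hcstarγ).eq
  -- (c) the glue + Hasse: `b b⋆ = x` with `b ∈ Z(γ)ˣ`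
  have hσ2 : IsCMField.complexConj L * IsCMField.complexConj L = 1 := AlgEquiv.ext fun r => IsCMField.complexConj_apply_apply L r
  obtain ⟨b, hbγ, hbu, hb⟩ := Literature.NumberTheory.GaloisRepresentations.exists_commute_mul_hermAdjoint_eq_of_adelic
    (IsCMField.complexConj L) hσ2 (IsCMField.complexConj_ne_one L) σr (fun _ => rfl) σA (fun z => adeleConj_apply L z)
    hHdet hH hregM hγU hxγ hxs hxu hcγ hcc
  -- (d) `t′ := b⁻¹`: `⋆t′ x t′ = 1`, i.e. `ᵗ(σ t′) H_g t′ = H`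
  have hbstarγ : Commute γM (H⁻¹ * (b.map σr)ᵀ * H) := commute_hermAdjoint_of_commute σr hHdet hγU hbγ.symm
  have hb' : (H⁻¹ * (b.map σr)ᵀ * H) * b = x := by
    rw [(commute_of_commute_of_charpoly_separable hregM hbstarγ.symm hbγ).eq]
    exact hb
  let bu : GL (Fin N) L := ((Matrix.isUnit_iff_isUnit_det b).2 hbu).unit
  have hbu_coe : (bu : Matrix (Fin N) (Fin N) L) = b := ((Matrix.isUnit_iff_isUnit_det b).2 hbu).unit_spec
  refine isConj_of_exists_unitary_conj ((exists_unitary_conj_iff_exists_commute_congr_eq σr H hg).2 ⟨bu⁻¹, ?_, ?_⟩)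
  · -- `b⁻¹` commutes with `γ`
    apply Units.ext
    have hbi : ((bu⁻¹ : GL (Fin N) L) : Matrix (Fin N) (Fin N) L) = b⁻¹ := by rw [Matrix.coe_units_inv, hbu_coe]
    rw [Units.val_mul, Units.val_mul, hbi]
    exact nonsing_inv_mul_eq_mul_nonsing_inv_of_commute hbu hbγ.symm
  · -- `ᵗ(σ b⁻¹) H_g b⁻¹ = H`
    have hbi : ((bu⁻¹ : GL (Fin N) L) : Matrix (Fin N) (Fin N) L) = b⁻¹ := by rw [Matrix.coe_units_inv, hbu_coe]
    rw [hbi]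
    -- `⋆(b⁻¹) · x · b⁻¹ = ⋆(b⁻¹) ⋆b b b⁻¹ = ⋆(b b⁻¹) = 1`
    have hstar : (H⁻¹ * ((b⁻¹).map σr)ᵀ * H) * x * b⁻¹ = 1 := by
      rw [← hb']
      calc H⁻¹ * ((b⁻¹).map σr)ᵀ * H * (H⁻¹ * (b.map σr)ᵀ * H * b) * b⁻¹
          = (H⁻¹ * ((b⁻¹).map σr)ᵀ * H) * (H⁻¹ * (b.map σr)ᵀ * H) * (b * b⁻¹) := by simp only [Matrix.mul_assoc]
        _ = 1 := by rw [← hermAdjoint_mul σr hHdet, Matrix.mul_nonsing_inv b hbu, hermAdjoint_one σr hHdet, Matrix.one_mul]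
    -- multiply `H · (⋆t′ x t′) = H`: `ᵗ(σt′) (H x) t′ = H`, `H x = Hg`
    have hHx : H * x = Hg := by rw [hx, ← Matrix.mul_assoc, Matrix.mul_nonsing_inv H hHdet, Matrix.one_mul]
    calc ((b⁻¹).map σr)ᵀ * Hg * b⁻¹ = H * (H⁻¹ * ((b⁻¹).map σr)ᵀ * H * x * b⁻¹) := by
          rw [← hHx]
          calc ((b⁻¹).map σr)ᵀ * (H * x) * b⁻¹ = (H * H⁻¹) * ((b⁻¹).map σr)ᵀ * H * x * b⁻¹ := by
                rw [Matrix.mul_nonsing_inv H hHdet, Matrix.one_mul]; simp only [Matrix.mul_assoc]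
            _ = _ := by simp only [Matrix.mul_assoc]
      _ = H := by rw [hstar, Matrix.mul_one]

/-- **`k(γ₀) = 1` in class form** (the shape ★ `PreStabilisationCountSelf` consumes): for `γ₀ ∈ U(H)(L⁺)` regular, `[δ] ↦ [δ ⊗ 1]` is INJECTIVE on
the `U(H)(L⁺)`-classes inside the stable class of `γ₀`. [cite: Rogawski1990, §5.4 p. 72] [cite: Kottwitz1986, §9] -/
theorem UnitaryGroup.injOn_conjClassesMap_toAdelic (hH : (H.map (cmConjRingHom L))ᵀ = H) (hHdet : IsUnit H.det)
    {γ₀ : (UnitaryGroup.cmDatum L N H).Rational} (hreg : IsRegularElt ((γ₀ : unitaryGroup (cmConjRingHom L) H).val : GL (Fin N) L)) :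
    Set.InjOn (ConjClasses.map (UnitaryGroup.cmDatum L N H).toAdelic) (conjClassesIn (cmConjRingHom L) H γ₀) :=
  injOn_conjClassesMap_toAdelic_of (fun _ _ hγ hc => UnitaryGroup.isConj_of_isConj_toAdelic hH hHdet hγ hc) hreg

end Literature.NumberTheory.Rogawski1990

end
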